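import Summits.QuantumFields.BalabanUV.Beta.GAN24.BornLambdaRowHolds
import Summits.QuantumFields.BalabanUV.Beta.GAN24.BornLambdaContactBound
import Summits.QuantumFields.BalabanUV.Beta.GAN24.StencilSlotLamDriftRoot
import Summits.QuantumFields.BalabanUV.Beta.GAN24.StencilSlotCauchyOfShapes
import Summits.QuantumFields.BalabanUV.Beta.GAN24.KSlotAssembly
import Literature.MathematicalPhysics.QuantumFieldTheory.Balaban1983to89.T4FlagMemoryPolyWeight

/-!
# `BalabanUV.Beta.GAN24.BornLambdaDrift` — binder row G-an2-4 ∕ (CONV-C), the row owner's CONTACT-TERM ROUTE (R8°), THE RATE HALF OF THE Λ-BORN ROW: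
# **`hBdev(0,cΛ)` — the all-scales Cauchy letter of the unit tables of the Λ-born remainder `bornSecAt Lc ρ cE 0 cΛ` — REDUCED TO THE TOP-ALIGNED
# PAIR LETTERS ALONE** (the born-sector analogue of the owner's `gen19/CT4-DESIGN-v0.md` §0 «it suffices to bound CONSECUTIVE differences»; the
# fresh-source drift and the top lineage are DISCHARGED at `d = 3` from tree names)

NOT IN PRINT; OUR BOOKKEEPING (G-an2-4 formalisation swarm → CRUX TEAM (2), leaf prover `b2b-balaban-gan24-formalise-leaf-06`, gen 41; journal
`CLAIMS.log` INTENT «BORN-Λ-DRIFT SOCKET»).  HONEST FRAMING (cell contract, verbatim): «discharging `BetaPertH` makes Bałaban's UV stability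
UNCONDITIONAL — a real constructive-QFT result; it is NOT the continuum limit and NOT the Clay problem.»  HONEST DEPENDENCY (verbatim): «continuum
YM on T⁴ ⇐ BetaPertH ∧ nine spine estimates (0/9 proved); BetaPertH ⇐ (D1) ∧ (D4) ∧ CAP+tail; G-an2-4 gates asym, D1 and NE2/3/4.»
[folklore] real analysis + bookkeeping over TREE names BY NAME (leaf-01 g59's `BornLambdaLineage.unitS_bornLam_eq_sum_push₃` ∕ `exists_hX_lam_three`,
leaf-03 g40's `StencilSlotLamDriftRoot.locStencil_unitS_lamPiece_sub`, road P1's `KSlotAssembly.convCKWall_holds`, the owner's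
`BornLambdaRowHolds.exists_hUg_three`, leaf-02 g49's `BornLambdaContactBound.exists_hCg_three`, ne7-side `T4FlagMemoryPolyWeight.exists_bound_succ_pow_mul_pow`);
0 `def`, 0 cited facts, 0 `def … : Prop`, 0 sorry; NO estimate of Bałaban's; discharges NOTHING of (hS, hSall) on (E): the END is a SOCKET whose one
hypothesis (the pair letters) is OPEN.  NEVER «G-an2-4 closed» as (CONV-C); NOT D1, NOT `BetaPertH`, NOT continuum, NOT Clay.

## The reduction (why top-aligned pairs)
In units the Λ-born remainder of member `k` is `U_k = F_k + Σ_{i<k} ℓ(i,k)`: the fresh source `F_k = unitS_k (freshAt … k)` plus, per birth level `i < k`,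
`ℓ(i,k) = (cE·Lc^{2(d+1)})^{k−i} • push₃ (T_{i,k})³ (unitS_i (freshAt … i))`, `T_{i,k} = legChain (respStepBmSeq ρ Lc) i (k−1−i)` (`unitS_bornLam_eq_sum_push₃`).  Pairing
member `k+1`'s lineage born at `i+1` with member `k`'s born at `i` (SAME relative depth, weight and chain length; they differ by one more fine level underneath,
i.e. by the refinement letters (C-N1_m) ∕ CT-4b ∕ `hKall`) gives EXACTLY (`consec_eq`) `U_{k+1} − U_k = (F_{k+1} − F_k) + ℓ(0,k+1) + Σ_{i<k} (ℓ(i+1,k+1) − ℓ(i,k))`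
— fresh drift + TOP lineage + top-aligned PAIRS; so (`exists_consec_of_pairLetters`) letters `CF·θF^k`, `CT·(k+1)^p·θT^{k+1}`, `CP·(k−i)^q·Θ^k` give a
consecutive letter `C·θ^k` (one `θ < 1` above the three rates, polynomials absorbed) and (`locStencil_allScales_of_consec`) the all-scales letter
`C∕(1−θ)·θ^k` — the `hSdev`-shape, `θ` FREE as the consumer `FP.RoadLeftAssemblyRows` allows.

## Contents
§1 (generic `d`; ABSTRACT `F`, `ℓ`): `consec_eq`, **`locStencil_allScales_of_consec`**, **`exists_consec_of_pairLetters`** (the V half and the Wilson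
sector are instances of the same schema; not instantiated here).  §2 (generic `d`, in-block root) **`exists_hBdevLam_of_letters`**: fresh drift `hXd` + top
lineage `hT` + pairs `hP` ⇒ `hBdev(0,cΛ)`.  §3 (`d = 3`, `2 ≤ Lc`, pin `cE = Lc^4`) **`exists_hXd_lam_three`** (the fresh Λ-source drift from the K-slot's
`hK ∧ hKall`: `locStencil_unitS_lamPiece_sub` under `freshAt_lam_succ`, members `≥ 1`; the pair `(1,0)` by `exists_hX_lam_three`), **`exists_hT_lam_three`**
(top lineage = `exists_hUg_three` + `exists_hCg_three` at `i = 0`, `p = 1`), END **`exists_hBdevLam_three_of_pairs`**: `hBdev(0,cΛ) ⟸ THE PAIR LETTERS ALONE`.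
THE PAIR LETTER (for its typist; NOT proved here): per lineage, by trilinearity of `push₃`, ONE differenced factor at a time — legs ((C-N1_m)
`RespStepCauchy.exists_respStep_cauchy`, CT-4b's staircase differences, base level free) or the source (`exists_hXd_lam_three`); road S3's DIFF rows
(`S3DiffL.diffL_three`, product form `eL·θ^{n+1}·ρ^{n−m}`) are the undressed instance at the corner root.
Unit `b2b-balaban-gan24-formalise-leaf-06` (gen 41), 2026-08-21.
-/

noncomputable section

open Finset
open scoped BigOperators
open Literature.MathematicalPhysics.QuantumFieldTheory
open Literature.MathematicalPhysics.QuantumFieldTheory.Balaban1983to89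
open Literature.MathematicalPhysics.QuantumFieldTheory.Balaban1983to89.Beta
open Literature.MathematicalPhysics.QuantumFieldTheory.Balaban1983to89.T4FlagMemoryPolyWeight (exists_bound_succ_pow_mul_pow)
open ExpKernelCalculus (MKer Zl)
open OneStepResolventKernel (Fib LocStencil)
open AffineAveraging (box toSite)
open StepJetData (locStencil_add)
open AveragingHessianKernels (ell)
open AveragingMixedJetTables (zero_mem_box)
open BalabanCompositeJets (respStep)
open Summit.QuantumFields.BalabanUV.Beta.HessKerDressedUnits (unitS)
open Summit.QuantumFields.BalabanUV.Beta.GAN24.CombesThomas (sfStep smStep UnitDecayK CauchyDecayK)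
open Summit.QuantumFields.BalabanUV.Beta.GAN24.StencilSlotOfShapes (locStencil_mono')
open Summit.QuantumFields.BalabanUV.Beta.GAN24.StencilSlotCauchyOfShapes (locStencil_sub)
open Summit.QuantumFields.BalabanUV.Beta.GAN24.BornLambdaLetters (locStencil_finset_sum)
open Summit.QuantumFields.BalabanUV.Beta.GAN24.Push3 (push₃)
open Summit.QuantumFields.BalabanUV.Beta.GAN24.Push4Iter (legChain)
open Summit.QuantumFields.BalabanUV.Beta.GAN24.RespStepBmDecompExact (respStepBmSeq)
open Summit.QuantumFields.BalabanUV.Beta.GAN24.SrecWilsonSector (bornSecAt)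
open Summit.QuantumFields.BalabanUV.Beta.GAN24.SrecBornSector (freshAt)
open Summit.QuantumFields.BalabanUV.Beta.GAN24.BornLambdaLineage (unitS_bornLam_eq_sum_push₃ freshAt_lam_succ exists_hX_lam_three)
open Summit.QuantumFields.BalabanUV.Beta.GAN24.StencilSlotLamDriftRoot (locStencil_unitS_lamPiece_sub)
open Summit.QuantumFields.BalabanUV.Beta.GAN24.KSlotAssembly (convCKWall_holds)
open Summit.QuantumFields.BalabanUV.Beta.GAN24.BornLambdaRowHolds (exists_hUg_three)
open Summit.QuantumFields.BalabanUV.Beta.GAN24.BornLambdaContactBound (exists_hCg_three)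

namespace Summit.QuantumFields.BalabanUV.Beta.GAN24.BornLambdaDrift

variable {d : ℕ}

/-! ## §1 The schema: consecutive differences of a lineage sum, and telescoping -/

/-- [folklore] **THE TOP-ALIGNED PAIRING, AS AN IDENTITY** (`Finset.sum_range_succ'`): member `k+1`'s lineage born at `i+1` is paired with member `k`'s born
at `i`; the top lineage `ℓ 0 (k+1)` is unpaired. -/
theorem consec_eq (F : ℕ → Fin (d + 1) → (Fin (d + 1) → ℤ) → MKer (d + 1) (Fib d))
    (ℓ : ℕ → ℕ → Fin (d + 1) → (Fin (d + 1) → ℤ) → MKer (d + 1) (Fib d)) (k : ℕ) :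
    (F (k + 1) + ∑ i ∈ Finset.range (k + 1), ℓ i (k + 1)) - (F k + ∑ i ∈ Finset.range k, ℓ i k)
      = (F (k + 1) - F k) + ℓ 0 (k + 1) + ∑ i ∈ Finset.range k, (ℓ (i + 1) (k + 1) - ℓ i k) := by
  rw [Finset.sum_range_succ' (fun i => ℓ i (k + 1)), Finset.sum_sub_distrib]
  abel

/-- [folklore] The partial geometric sums are bounded by the full one: `Σ_{n<j} θ^n ≤ (1−θ)⁻¹` for `0 ≤ θ < 1`. -/
theorem sum_range_pow_le_inv {θ : ℝ} (hθ0 : 0 ≤ θ) (hθ1 : θ < 1) (j : ℕ) :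
    ∑ n ∈ Finset.range j, θ ^ n ≤ (1 - θ)⁻¹ := by
  have h1 : 0 < 1 - θ := by linarith
  have e : ∑ n ∈ Finset.range j, θ ^ n = (1 - θ ^ j) / (1 - θ) := by
    rw [eq_div_iff h1.ne', mul_comm]
    exact mul_neg_geom_sum θ j
  have hj : 0 ≤ θ ^ j := pow_nonneg hθ0 j
  rw [e, div_le_iff₀ h1, inv_mul_cancel₀ h1.ne']
  linarith

/-- [folklore] **CONSECUTIVE ⇒ ALL SCALES** (telescoping + the geometric series): if `U (k+1) − U k` is a local stencil family with constant `C·θ^k` at one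
rate for every `k` (`0 ≤ C`, `0 ≤ θ < 1`), then `U (k+j) − U k` is one with constant `(C∕(1−θ))·θ^k` for all `k j` — the `hSdev` ∕ `hSall` shape. -/
theorem locStencil_allScales_of_consec {U : ℕ → Fin (d + 1) → (Fin (d + 1) → ℤ) → MKer (d + 1) (Fib d)} {C θ δ : ℝ}
    (hC : 0 ≤ C) (hθ0 : 0 ≤ θ) (hθ1 : θ < 1) (h : ∀ k, LocStencil (U (k + 1) - U k) (C * θ ^ k) δ) (k j : ℕ) :
    LocStencil (U (k + j) - U k) (C / (1 - θ) * θ ^ k) δ := by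
  have key : ∀ j, LocStencil (U (k + j) - U k) (C * θ ^ k * ∑ n ∈ Finset.range j, θ ^ n) δ := by
    intro j
    induction j with
    | zero =>
        simp only [Nat.add_zero, sub_self, Finset.sum_range_zero, mul_zero]
        intro κ u x y a b
        simp
    | succ j ih =>
        have e : U (k + (j + 1)) - U k = (U (k + j + 1) - U (k + j)) + (U (k + j) - U k) := by
          rw [← Nat.add_assoc]
          abel
        rw [e]
        refine locStencil_mono' (locStencil_add (h (k + j)) ih) (le_of_eq ?_) le_rfl
        rw [Finset.sum_range_succ, pow_add]
        ring
  have h1 : 0 < 1 - θ := by linarith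
  refine locStencil_mono' (key j) ?_ le_rfl
  calc C * θ ^ k * ∑ n ∈ Finset.range j, θ ^ n ≤ C * θ ^ k * (1 - θ)⁻¹ :=
        mul_le_mul_of_nonneg_left (sum_range_pow_le_inv hθ0 hθ1 j) (by positivity)
    _ = C / (1 - θ) * θ ^ k := by rw [div_eq_mul_inv]; ring

/-- [folklore] **THE SCHEMA — A CONSECUTIVE LETTER FROM THREE LETTERS**: a fresh-source drift `CF·θF^k`, a top-lineage letter `CT·(k+1)^p·θT^{k+1}` and top-aligned
pair letters `CP·(k−i)^q·Θ^k` (all at one rate `δ`; `θF, θT, Θ < 1`) give, for EVERY fresh sequence `F` and lineage table `ℓ` obeying them, the consecutive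
difference of `U k = F k + Σ_{i<k} ℓ i k` as a local stencil family with constant `C·θ^k` — ONE `0 < θ < 1` above the three rates (any `θ` in `(max, 1)` would do;
here `θ = (1 + max)/2`), the polynomial weights absorbed by `T4FlagMemoryPolyWeight.exists_bound_succ_pow_mul_pow`; `C, θ` depend on the letters' constants
ONLY (so: uniform in the in-block root when the letters are). -/
theorem exists_consec_of_pairLetters {δ CF θF CT θT CP Θ : ℝ} {p q : ℕ}
    (hCF : 0 ≤ CF) (hθF0 : 0 ≤ θF) (hθF1 : θF < 1) (hCT : 0 ≤ CT) (hθT0 : 0 ≤ θT) (hθT1 : θT < 1)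
    (hCP : 0 ≤ CP) (hΘ0 : 0 ≤ Θ) (hΘ1 : Θ < 1) :
    ∃ C θ : ℝ, 0 ≤ C ∧ 0 < θ ∧ θ < 1 ∧
      ∀ (F : ℕ → Fin (d + 1) → (Fin (d + 1) → ℤ) → MKer (d + 1) (Fib d))
        (ℓ : ℕ → ℕ → Fin (d + 1) → (Fin (d + 1) → ℤ) → MKer (d + 1) (Fib d)),
        (∀ k, LocStencil (F (k + 1) - F k) (CF * θF ^ k) δ) →
        (∀ k, LocStencil (ℓ 0 (k + 1)) (CT * ((((k + 1 : ℕ) : ℝ)) ^ p * θT ^ (k + 1))) δ) →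
        (∀ k i, i < k → LocStencil (ℓ (i + 1) (k + 1) - ℓ i k) (CP * ((((k - i : ℕ) : ℝ)) ^ q * Θ ^ k)) δ) →
        ∀ k, LocStencil ((F (k + 1) + ∑ i ∈ Finset.range (k + 1), ℓ i (k + 1)) - (F k + ∑ i ∈ Finset.range k, ℓ i k))
          (C * θ ^ k) δ := by
  have a1 := le_max_left θF (max θT Θ)
  have a2 := le_max_right θF (max θT Θ)
  have a3 := le_max_left θT Θ
  have a4 := le_max_right θT Θ
  have b : max θF (max θT Θ) < 1 := max_lt hθF1 (max_lt hθT1 hΘ1)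
  obtain ⟨s, hs0, hs1, hθFs, hθTs, hΘs⟩ : ∃ s : ℝ, 0 < s ∧ s < 1 ∧ θF ≤ s ∧ θT < s ∧ Θ < s :=
    ⟨(1 + max θF (max θT Θ)) / 2, by linarith, by linarith, by linarith, by linarith, by linarith⟩
  have hsne : s ≠ 0 := hs0.ne'
  -- the two polynomial weights absorbed into the ratio rates
  have hrT0 : 0 ≤ θT / s := div_nonneg hθT0 hs0.le
  have hrT1 : θT / s < 1 := (div_lt_one hs0).2 hθTs
  have hrP0 : 0 ≤ Θ / s := div_nonneg hΘ0 hs0.le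
  have hrP1 : Θ / s < 1 := (div_lt_one hs0).2 hΘs
  obtain ⟨BT, hBT1, hBT⟩ := exists_bound_succ_pow_mul_pow hrT0 hrT1 p
  obtain ⟨BP, hBP1, hBP⟩ := exists_bound_succ_pow_mul_pow hrP0 hrP1 (q + 1)
  have hBT0 : 0 ≤ BT := zero_le_one.trans hBT1
  have hBP0 : 0 ≤ BP := zero_le_one.trans hBP1
  refine ⟨CF + CT * θT * BT + CP * BP, s, by positivity, hs0, hs1, fun F ℓ hF hT hP k => ?_⟩
  rw [consec_eq]
  have h1 : LocStencil (F (k + 1) - F k) (CF * s ^ k) δ :=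
    locStencil_mono' (hF k) (mul_le_mul_of_nonneg_left (pow_le_pow_left₀ hθF0 hθFs k) hCF) le_rfl
  have h2 : LocStencil (ℓ 0 (k + 1)) (CT * θT * BT * s ^ k) δ := by
    refine locStencil_mono' (hT k) ?_ le_rfl
    have e : CT * ((((k + 1 : ℕ) : ℝ)) ^ p * θT ^ (k + 1)) = CT * θT * ((((k : ℝ)) + 1) ^ p * (θT / s) ^ k) * s ^ k := by
      rw [div_pow, pow_succ]
      push_cast
      field_simp
    rw [e]
    exact mul_le_mul_of_nonneg_right (mul_le_mul_of_nonneg_left (hBT k) (mul_nonneg hCT hθT0)) (pow_nonneg hs0.le k)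
  -- (3) the top-aligned pairs: `Σ_{i<k} CP (k−i)^q Θ^k ≤ CP·(k+1)^{q+1}·(Θ∕s)^k·s^k ≤ CP·BP·s^k`
  have h3 : LocStencil (∑ i ∈ Finset.range k, (ℓ (i + 1) (k + 1) - ℓ i k)) (CP * BP * s ^ k) δ := by
    have hsum := locStencil_finset_sum (Finset.range k) (C := fun i => CP * ((((k - i : ℕ) : ℝ)) ^ q * Θ ^ k))
      fun i hi => hP k i (Finset.mem_range.1 hi)
    refine locStencil_mono' hsum ?_ le_rfl
    have hterm : ∀ i ∈ Finset.range k, CP * ((((k - i : ℕ) : ℝ)) ^ q * Θ ^ k) ≤ CP * (((k : ℝ)) ^ q * Θ ^ k) := by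
      intro i _
      refine mul_le_mul_of_nonneg_left (mul_le_mul_of_nonneg_right ?_ (pow_nonneg hΘ0 k)) hCP
      exact pow_le_pow_left₀ (Nat.cast_nonneg _) (by exact_mod_cast Nat.sub_le k i) q
    have hk1 : (k : ℝ) * (k : ℝ) ^ q ≤ ((k : ℝ) + 1) ^ (q + 1) := by
      rw [pow_succ']
      exact mul_le_mul (by linarith) (pow_le_pow_left₀ (Nat.cast_nonneg _) (by linarith) q) (by positivity) (by positivity)
    have e : (Θ / s) ^ k * s ^ k = Θ ^ k := by
      rw [div_pow, div_mul_cancel₀ _ (pow_ne_zero k hsne)]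
    calc ∑ i ∈ Finset.range k, CP * ((((k - i : ℕ) : ℝ)) ^ q * Θ ^ k)
        ≤ ∑ i ∈ Finset.range k, CP * (((k : ℝ)) ^ q * Θ ^ k) := Finset.sum_le_sum hterm
      _ = (k : ℝ) * (CP * (((k : ℝ)) ^ q * Θ ^ k)) := by rw [Finset.sum_const, Finset.card_range, nsmul_eq_mul]
      _ = CP * (((k : ℝ) * (k : ℝ) ^ q) * Θ ^ k) := by ring
      _ ≤ CP * (((k : ℝ) + 1) ^ (q + 1) * Θ ^ k) :=
          mul_le_mul_of_nonneg_left (mul_le_mul_of_nonneg_right hk1 (pow_nonneg hΘ0 k)) hCP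
      _ = CP * ((((k : ℝ)) + 1) ^ (q + 1) * (Θ / s) ^ k) * s ^ k := by rw [← e]; ring
      _ ≤ CP * BP * s ^ k := mul_le_mul_of_nonneg_right (mul_le_mul_of_nonneg_left (hBP k) hCP) (pow_nonneg hs0.le k)
  exact locStencil_mono' (locStencil_add (locStencil_add h1 h2) h3) (le_of_eq (by ring)) le_rfl

/-! ## §2 The Λ-born instance (generic `d`, in-block root): `hBdev(0,cΛ)` from three letters -/

section Letters

variable {Lc : ℕ} [NeZero Lc]

/-- NOT IN PRINT; OUR BOOKKEEPING (generic `d`, in-block root; a SOCKET).  **THE RATE HALF OF THE Λ-BORN ROW FROM THREE LETTERS**: a fresh-source drift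
`hXd` (`CF·θF^k`), a TOP-lineage letter `hT` (born at the finest level, observed at `k+1`: `CT·(k+1)^p·θT^{k+1}`) and the TOP-ALIGNED PAIR letters `hP` (member
`k+1`'s lineage born at `i+1` minus member `k`'s born at `i`: `CP·(k−i)^q·Θ^k`), all uniform in the in-block root, give the all-scales Cauchy letter
`LocStencil (U_{k+j} − U_k) (cB·θB^k) δB` of the unit tables of `bornSecAt Lc ρ cE 0 cΛ` — ONE `cB ≥ 0`, ONE `0 ≤ θB < 1`, ONE `δB > 0` for all `k j` and roots. -/
theorem exists_hBdevLam_of_letters (cE cΛ : ℝ) {p q : ℕ}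
    (hXd : ∃ CF θF δF : ℝ, 0 ≤ CF ∧ 0 ≤ θF ∧ θF < 1 ∧ 0 < δF ∧ ∀ (rr : Fin (d + 1) → ℕ), rr ∈ box (d + 1) Lc → ∀ k : ℕ,
      LocStencil (unitS (sfStep Lc (k + 1)) (smStep d Lc (k + 1)) (freshAt Lc (toSite rr) 0 cΛ (k + 1))
        - unitS (sfStep Lc k) (smStep d Lc k) (freshAt Lc (toSite rr) 0 cΛ k)) (CF * θF ^ k) δF)
    (hT : ∃ CT θT δT : ℝ, 0 ≤ CT ∧ 0 ≤ θT ∧ θT < 1 ∧ 0 < δT ∧ ∀ (rr : Fin (d + 1) → ℕ), rr ∈ box (d + 1) Lc → ∀ k : ℕ,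
      LocStencil (fun κ' u' => (cE * (Lc : ℝ) ^ (2 * (d + 1))) ^ (k + 1) •
        push₃ (legChain (respStepBmSeq (toSite rr) Lc) 0 k) (legChain (respStepBmSeq (toSite rr) Lc) 0 k) (legChain (respStepBmSeq (toSite rr) Lc) 0 k)
          (unitS (sfStep Lc 0) (smStep d Lc 0) (freshAt Lc (toSite rr) 0 cΛ 0)) κ' u') (CT * ((((k + 1 : ℕ) : ℝ)) ^ p * θT ^ (k + 1))) δT)
    (hP : ∃ CP Θ δP : ℝ, 0 ≤ CP ∧ 0 ≤ Θ ∧ Θ < 1 ∧ 0 < δP ∧ ∀ (rr : Fin (d + 1) → ℕ), rr ∈ box (d + 1) Lc → ∀ k i : ℕ, i < k →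
      LocStencil
        ((fun κ' u' => (cE * (Lc : ℝ) ^ (2 * (d + 1))) ^ (k - i) •
            push₃ (legChain (respStepBmSeq (toSite rr) Lc) (i + 1) (k - 1 - i)) (legChain (respStepBmSeq (toSite rr) Lc) (i + 1) (k - 1 - i))
              (legChain (respStepBmSeq (toSite rr) Lc) (i + 1) (k - 1 - i))
              (unitS (sfStep Lc (i + 1)) (smStep d Lc (i + 1)) (freshAt Lc (toSite rr) 0 cΛ (i + 1))) κ' u')
          - fun κ' u' => (cE * (Lc : ℝ) ^ (2 * (d + 1))) ^ (k - i) •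
            push₃ (legChain (respStepBmSeq (toSite rr) Lc) i (k - 1 - i)) (legChain (respStepBmSeq (toSite rr) Lc) i (k - 1 - i))
              (legChain (respStepBmSeq (toSite rr) Lc) i (k - 1 - i))
              (unitS (sfStep Lc i) (smStep d Lc i) (freshAt Lc (toSite rr) 0 cΛ i)) κ' u')
        (CP * ((((k - i : ℕ) : ℝ)) ^ q * Θ ^ k)) δP) :
    ∃ cB θB δB : ℝ, 0 ≤ cB ∧ 0 ≤ θB ∧ θB < 1 ∧ 0 < δB ∧ ∀ (rr : Fin (d + 1) → ℕ), rr ∈ box (d + 1) Lc → ∀ k j : ℕ,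
      LocStencil (unitS (sfStep Lc (k + j)) (smStep d Lc (k + j)) (bornSecAt Lc (toSite rr) cE 0 cΛ (k + j))
        - unitS (sfStep Lc k) (smStep d Lc k) (bornSecAt Lc (toSite rr) cE 0 cΛ k)) (cB * θB ^ k) δB := by
  obtain ⟨CF, θF, δF, hCF, hθF0, hθF1, hδF, hXd⟩ := hXd
  obtain ⟨CT, θT, δT, hCT, hθT0, hθT1, hδT, hT⟩ := hT
  obtain ⟨CP, Θ, δP, hCP, hΘ0, hΘ1, hδP, hP⟩ := hP
  set δ : ℝ := min (min δF δT) δP with hδdef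
  have hδ0 : 0 < δ := lt_min (lt_min hδF hδT) hδP
  have hδF' : δ ≤ δF := (min_le_left _ _).trans (min_le_left _ _)
  have hδT' : δ ≤ δT := (min_le_left _ _).trans (min_le_right _ _)
  have hδP' : δ ≤ δP := min_le_right _ _
  obtain ⟨C, θ, hC, hθ0, hθ1, hschema⟩ :=
    exists_consec_of_pairLetters (d := d) (δ := δ) (p := p) (q := q) hCF hθF0 hθF1 hCT hθT0 hθT1 hCP hΘ0 hΘ1
  have h1θ : 0 < 1 - θ := by linarith
  refine ⟨C / (1 - θ), θ, δ, div_nonneg hC h1θ.le, hθ0.le, hθ1, hδ0, fun rr hrr k j => ?_⟩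
  have hconsec : ∀ k, LocStencil (unitS (sfStep Lc (k + 1)) (smStep d Lc (k + 1)) (bornSecAt Lc (toSite rr) cE 0 cΛ (k + 1))
      - unitS (sfStep Lc k) (smStep d Lc k) (bornSecAt Lc (toSite rr) cE 0 cΛ k)) (C * θ ^ k) δ := by
    intro k
    rw [unitS_bornLam_eq_sum_push₃ hrr cE cΛ (k + 1), unitS_bornLam_eq_sum_push₃ hrr cE cΛ k]
    refine hschema (fun k => unitS (sfStep Lc k) (smStep d Lc k) (freshAt Lc (toSite rr) 0 cΛ k))
      (fun i k => fun κ' u' => (cE * (Lc : ℝ) ^ (2 * (d + 1))) ^ (k - i) •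
        push₃ (legChain (respStepBmSeq (toSite rr) Lc) i (k - 1 - i)) (legChain (respStepBmSeq (toSite rr) Lc) i (k - 1 - i))
          (legChain (respStepBmSeq (toSite rr) Lc) i (k - 1 - i))
          (unitS (sfStep Lc i) (smStep d Lc i) (freshAt Lc (toSite rr) 0 cΛ i)) κ' u')
      (fun k => locStencil_mono' (hXd rr hrr k) le_rfl hδF') (fun k => ?_) (fun k i hik => ?_) k
    · -- the top lineage, raw indices `k + 1 - 0`, `k + 1 - 1 - 0` normalised
      have h := locStencil_mono' (hT rr hrr k) le_rfl hδT'
      simp only [Nat.sub_zero, Nat.add_sub_cancel]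
      exact h
    · -- the pair, raw indices `k + 1 - (i + 1)`, `k + 1 - 1 - (i + 1)` normalised
      have h := locStencil_mono' (hP rr hrr k i hik) le_rfl hδP'
      have e2 : k - (i + 1) = k - 1 - i := by omega
      simp only [Nat.add_sub_add_right, Nat.add_sub_cancel, e2]
      exact h
  exact locStencil_allScales_of_consec (U := fun k => unitS (sfStep Lc k) (smStep d Lc k) (bornSecAt Lc (toSite rr) cE 0 cΛ k))
    hC hθ0.le hθ1 hconsec k j

end Letters

/-! ## §3 `d = 3`: the fresh drift and the top lineage discharged; the END socket -/

section Discharge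

variable {Lc : ℕ} [NeZero Lc]

/-- NOT IN PRINT; OUR BOOKKEEPING (generic `d`; the K-slot data as HYPOTHESES).  **THE FRESH Λ-SOURCE DRIFTS GEOMETRICALLY IN THE BIRTH LEVEL**: `UnitDecayK … C δ`,
`CauchyDecayK … cK θ δ` (`0 < δ`, `0 ≤ θ < 1`) and a level-uniform letter `hX` for the fresh sources give `LocStencil (unitS_{k+1} fresh_{k+1} − unitS_k fresh_k) (CF·θF^k) δF`
with ONE `CF`, `θF = max θ ½`, all in-block roots — members `≥ 1` by leaf-03 g40's `StencilSlotLamDriftRoot.locStencil_unitS_lamPiece_sub` read through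
`BornLambdaLineage.freshAt_lam_succ`, the pair `(1, 0)` by `hX` twice. -/
theorem exists_hXd_lam_of_K (hLc : 1 ≤ Lc) {C cK θ δ : ℝ} (hK : UnitDecayK d Lc (sfStep Lc) (smStep d Lc) C δ)
    (hKall : CauchyDecayK d Lc (sfStep Lc) (smStep d Lc) cK θ δ) (hδ : 0 < δ) (hθ0 : 0 ≤ θ) (hθ1 : θ < 1) (cΛ : ℝ)
    (hX : ∃ CX δX : ℝ, 0 < δX ∧ ∀ (rr : Fin (d + 1) → ℕ), rr ∈ box (d + 1) Lc →
      ∀ k : ℕ, LocStencil (unitS (sfStep Lc k) (smStep d Lc k) (freshAt Lc (toSite rr) 0 cΛ k)) CX δX) :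
    ∃ CF θF δF : ℝ, 0 ≤ CF ∧ 0 ≤ θF ∧ θF < 1 ∧ 0 < δF ∧ ∀ (rr : Fin (d + 1) → ℕ), rr ∈ box (d + 1) Lc → ∀ k : ℕ,
      LocStencil (unitS (sfStep Lc (k + 1)) (smStep d Lc (k + 1)) (freshAt Lc (toSite rr) 0 cΛ (k + 1))
        - unitS (sfStep Lc k) (smStep d Lc k) (freshAt Lc (toSite rr) 0 cΛ k)) (CF * θF ^ k) δF := by
  obtain ⟨CX, δX, hδX, hX⟩ := hX
  set Cd : ℝ := |cΛ * (Lc : ℝ) ^ (2 * (d + 1))| *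
      ((d + 1 : ℕ) * (((Fintype.card (Fib d) : ℝ) * (cK * θ * C + C * cK) * Zl (d + 1) (δ - δ / 2)) *
        (2 * (ell (d + 1) Lc : ℝ) ^ 2 * Real.exp (4 * ((d : ℝ) + 1) * Lc * (δ / 2))) * Zl (d + 1) (δ / 2 / 2))) with hCd
  have hd : ∀ (rr : Fin (d + 1) → ℕ), rr ∈ box (d + 1) Lc → ∀ m : ℕ,
      LocStencil (unitS (sfStep Lc (m + 1 + 1)) (smStep d Lc (m + 1 + 1)) (freshAt Lc (toSite rr) 0 cΛ (m + 1 + 1))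
        - unitS (sfStep Lc (m + 1)) (smStep d Lc (m + 1)) (freshAt Lc (toSite rr) 0 cΛ (m + 1))) (Cd * θ ^ m) (δ / 2 / 2) := by
    intro rr hrr m
    rw [freshAt_lam_succ, freshAt_lam_succ]
    exact locStencil_unitS_lamPiece_sub hLc hrr hK hKall hδ hθ0 cΛ m 1
  have hroot : (fun _ : Fin (d + 1) => (0 : ℕ)) ∈ box (d + 1) Lc := zero_mem_box hLc
  have hCX : 0 ≤ CX := ((hX _ hroot 0) 0 0).nonneg (Sum.inl 0)
  have hCd0 : 0 ≤ Cd := by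
    have h := ((hd _ hroot 0) 0 0).nonneg (Sum.inl 0)
    simpa using h
  set θF : ℝ := max θ (1 / 2) with hθF
  have hθF0 : 0 < θF := lt_of_lt_of_le (by norm_num) (le_max_right _ _)
  have hθF1 : θF < 1 := max_lt hθ1 (by norm_num)
  have hθθF : θ ≤ θF := le_max_left _ _
  set δF : ℝ := min δX (δ / 2 / 2) with hδFdef
  have hδF0 : 0 < δF := lt_min hδX (by positivity)
  refine ⟨max (CX + CX) (Cd / θF), θF, δF, le_max_of_le_left (by positivity), hθF0.le, hθF1, hδF0, fun rr hrr k => ?_⟩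
  cases k with
  | zero =>
      have h := locStencil_sub (hX rr hrr (0 + 1)) (hX rr hrr 0)
      rw [pow_zero, mul_one]
      exact locStencil_mono' h (le_max_left _ _) (min_le_left _ _)
  | succ m =>
      -- members (m+2, m+1): the drift `Cd θ^m = (Cd/θF)·θF·θ^m ≤ (Cd/θF)·θF^(m+1)`
      have h := hd rr hrr m
      have hb : Cd * θ ^ m ≤ max (CX + CX) (Cd / θF) * θF ^ (m + 1) := by
        calc Cd * θ ^ m ≤ Cd * θF ^ m := mul_le_mul_of_nonneg_left (pow_le_pow_left₀ hθ0 hθθF m) hCd0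
          _ = Cd / θF * θF ^ (m + 1) := by rw [pow_succ]; field_simp
          _ ≤ max (CX + CX) (Cd / θF) * θF ^ (m + 1) :=
              mul_le_mul_of_nonneg_right (le_max_right _ _) (pow_nonneg hθF0.le _)
      exact locStencil_mono' h hb (min_le_right _ _)

/-- NOT IN PRINT; OUR BOOKKEEPING (`d = 3`, `2 ≤ Lc`, UNCONDITIONAL).  **THE FRESH Λ-SOURCE DRIFT OF THE `d = 3` FAMILY**: road P1's
`KSlotAssembly.convCKWall_holds` (`hK ∧ hKall` of the unit-normalised step resolvents) and leaf-01's `exists_hX_lam_three` discharge `exists_hXd_lam_of_K`. -/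
theorem exists_hXd_lam_three (hLc : 2 ≤ Lc) (cΛ : ℝ) :
    ∃ CF θF δF : ℝ, 0 ≤ CF ∧ 0 ≤ θF ∧ θF < 1 ∧ 0 < δF ∧ ∀ (rr : Fin (3 + 1) → ℕ), rr ∈ box (3 + 1) Lc → ∀ k : ℕ,
      LocStencil (unitS (sfStep Lc (k + 1)) (smStep 3 Lc (k + 1)) (freshAt Lc (toSite rr) 0 cΛ (k + 1))
        - unitS (sfStep Lc k) (smStep 3 Lc k) (freshAt Lc (toSite rr) 0 cΛ k)) (CF * θF ^ k) δF := by
  obtain ⟨C, δ, cK, θ, hδ, hθ0, hθ1, hK, hKall⟩ := convCKWall_holds (Lc := Lc) hLc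
  exact exists_hXd_lam_of_K (d := 3) (le_trans one_le_two hLc) hK hKall hδ hθ0 hθ1 cΛ (exists_hX_lam_three cΛ)

/-- NOT IN PRINT; OUR BOOKKEEPING (`d = 3`, `2 ≤ Lc`, pin `cE = Lc^4`, UNCONDITIONAL).  **THE TOP LINEAGE IS GEOMETRIC WITH ONE LOG**: the lineage born at the finest
level observed at `k+1` (weight `(cE·Lc^8)^{k+1}`, legs `legChain (respStepBmSeq ρ Lc) 0 k`) = undressed (the owner's `exists_hUg_three` at `i = 0`: `C·θ^{k+1}`) + contact
(leaf-02 g49's `exists_hCg_three` at `i = 0`, `p = 1`: `C·(k+1)·θ^{k+1}`) ⇒ constant `CT·(k+1)·θT^{k+1}`, `θT = max` of the two rates, uniformly in the root. -/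
theorem exists_hT_lam_three (hLc : 2 ≤ Lc) {cE : ℝ} (hcE : cE = (Lc : ℝ) ^ (3 + 1)) (cΛ : ℝ) :
    ∃ CT θT δT : ℝ, 0 ≤ CT ∧ 0 ≤ θT ∧ θT < 1 ∧ 0 < δT ∧ ∀ (rr : Fin (3 + 1) → ℕ), rr ∈ box (3 + 1) Lc → ∀ k : ℕ,
      LocStencil (fun κ' u' => (cE * (Lc : ℝ) ^ (2 * (3 + 1))) ^ (k + 1) •
        push₃ (legChain (respStepBmSeq (toSite rr) Lc) 0 k) (legChain (respStepBmSeq (toSite rr) Lc) 0 k) (legChain (respStepBmSeq (toSite rr) Lc) 0 k)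
          (unitS (sfStep Lc 0) (smStep 3 Lc 0) (freshAt Lc (toSite rr) 0 cΛ 0)) κ' u') (CT * ((((k + 1 : ℕ) : ℝ)) ^ 1 * θT ^ (k + 1))) δT := by
  obtain ⟨C₁, θ₁, δ₁, hC₁, hθ₁0, hθ₁1, hδ₁, hU⟩ := exists_hUg_three hLc hcE cΛ
  have hcE' : |cE| ≤ (Lc : ℝ) ^ 4 := by rw [hcE, abs_of_nonneg (by positivity)]
  obtain ⟨C₂, θ₂, δ₂, hC₂, hθ₂0, hθ₂1, hδ₂, hCg⟩ := exists_hCg_three hLc cE cΛ hcE'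
  set θT : ℝ := max θ₁ θ₂ with hθT
  have hθT0 : 0 ≤ θT := le_max_of_le_left hθ₁0
  have hθT1 : θT < 1 := max_lt hθ₁1 hθ₂1
  set δT : ℝ := min δ₁ δ₂ with hδT
  refine ⟨C₁ + C₂, θT, δT, by positivity, hθT0, hθT1, lt_min hδ₁ hδ₂, fun rr hrr k => ?_⟩
  have h1 := hU rr hrr (k + 1) 0 (Nat.zero_lt_succ k)
  have h2 := hCg rr hrr (k + 1) 0 (Nat.zero_lt_succ k)
  simp only [Nat.sub_zero, Nat.add_sub_cancel, pow_one] at h1 h2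
  have e : (fun κ' u' => (cE * (Lc : ℝ) ^ (2 * (3 + 1))) ^ (k + 1) •
        push₃ (legChain (respStepBmSeq (toSite rr) Lc) 0 k) (legChain (respStepBmSeq (toSite rr) Lc) 0 k) (legChain (respStepBmSeq (toSite rr) Lc) 0 k)
          (unitS (sfStep Lc 0) (smStep 3 Lc 0) (freshAt Lc (toSite rr) 0 cΛ 0)) κ' u')
      = (fun κ' u' => (fun κ' u' => (cE * (Lc : ℝ) ^ (2 * (3 + 1))) ^ (k + 1) •
            push₃ (respStep (d := 3) (Lc ^ 0) (Lc ^ (k + 1))) (respStep (d := 3) (Lc ^ 0) (Lc ^ (k + 1))) (respStep (d := 3) (Lc ^ 0) (Lc ^ (k + 1)))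
              (unitS (sfStep Lc 0) (smStep 3 Lc 0) (freshAt Lc (toSite rr) 0 cΛ 0)) κ' u') κ' u'
          + (fun κ' u' => (cE * (Lc : ℝ) ^ (2 * (3 + 1))) ^ (k + 1) •
            (push₃ (legChain (respStepBmSeq (toSite rr) Lc) 0 k) (legChain (respStepBmSeq (toSite rr) Lc) 0 k) (legChain (respStepBmSeq (toSite rr) Lc) 0 k)
                (unitS (sfStep Lc 0) (smStep 3 Lc 0) (freshAt Lc (toSite rr) 0 cΛ 0)) κ' u'
              - push₃ (respStep (d := 3) (Lc ^ 0) (Lc ^ (k + 1))) (respStep (d := 3) (Lc ^ 0) (Lc ^ (k + 1))) (respStep (d := 3) (Lc ^ 0) (Lc ^ (k + 1)))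
                (unitS (sfStep Lc 0) (smStep 3 Lc 0) (freshAt Lc (toSite rr) 0 cΛ 0)) κ' u')) κ' u') := by
    funext κ' u'
    simp only [smul_sub, add_sub_cancel]
  rw [e]
  have h := locStencil_add (locStencil_mono' h1 le_rfl (min_le_left δ₁ δ₂)) (locStencil_mono' h2 le_rfl (min_le_right δ₁ δ₂))
  refine locStencil_mono' h ?_ le_rfl
  -- `C₁ θ₁^(k+1) + C₂ (k+1) θ₂^(k+1) ≤ (C₁ + C₂) (k+1) θT^(k+1)`
  have hk1 : (1 : ℝ) ≤ ((k + 1 : ℕ) : ℝ) := by exact_mod_cast Nat.succ_le_succ (Nat.zero_le k)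
  have hp1 : θ₁ ^ (k + 1) ≤ θT ^ (k + 1) := pow_le_pow_left₀ hθ₁0 (le_max_left _ _) _
  have hp2 : θ₂ ^ (k + 1) ≤ θT ^ (k + 1) := pow_le_pow_left₀ hθ₂0 (le_max_right _ _) _
  have hTk : 0 ≤ θT ^ (k + 1) := pow_nonneg hθT0 _
  push_cast at hk1 ⊢
  nlinarith [mul_nonneg hC₁ hTk, mul_nonneg hC₂ hTk, mul_le_mul_of_nonneg_left hp1 hC₁, mul_le_mul_of_nonneg_left hp2 hC₂,
    mul_nonneg (mul_nonneg hC₁ hTk) (sub_nonneg.2 hk1), mul_nonneg hC₂ (pow_nonneg hθ₂0 (k + 1))]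

/-- NOT IN PRINT; OUR PROOF ATTEMPT — A SOCKET (`d = 3`, `2 ≤ Lc`, pin `cE = Lc^4`; [folklore] assembly).  **THE RATE HALF `hBdev(0,cΛ)` OF THE Λ-BORN ROW OF
THE `d = 3` COMB FAMILY FROM THE TOP-ALIGNED PAIR LETTERS ALONE**: if for every in-block root and every `i < k` the lineage of member `k+1` born at `i+1` minus
the lineage of member `k` born at `i` (same weight `(cE·Lc^8)^{k−i}`, same chain length) is a local stencil family with constant `CP·(k−i)^q·Θ^k` (`Θ < 1`, one
rate `δP`), then the unit tables of `bornSecAt Lc ρ cE 0 cΛ` obey the all-scales Cauchy letter `LocStencil (U_{k+j} − U_k) (cB·θB^k) δB` with ONE `cB`, ONE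
`θB < 1`, ONE `δB`, for all `k j` and all in-block roots — the fresh-source drift (`exists_hXd_lam_three`) and the top lineage (`exists_hT_lam_three`) are TREE.
The pair letter is NOT proved here; NOT hSdev of the comb family (needs the Wilson sector's CT-4e and the V half's twin); NEVER «G-an2-4 closed». -/
theorem exists_hBdevLam_three_of_pairs (hLc : 2 ≤ Lc) {cE : ℝ} (hcE : cE = (Lc : ℝ) ^ (3 + 1)) (cΛ : ℝ) (q : ℕ)
    (hP : ∃ CP Θ δP : ℝ, 0 ≤ CP ∧ 0 ≤ Θ ∧ Θ < 1 ∧ 0 < δP ∧ ∀ (rr : Fin (3 + 1) → ℕ), rr ∈ box (3 + 1) Lc → ∀ k i : ℕ, i < k →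
      LocStencil
        ((fun κ' u' => (cE * (Lc : ℝ) ^ (2 * (3 + 1))) ^ (k - i) •
            push₃ (legChain (respStepBmSeq (toSite rr) Lc) (i + 1) (k - 1 - i)) (legChain (respStepBmSeq (toSite rr) Lc) (i + 1) (k - 1 - i))
              (legChain (respStepBmSeq (toSite rr) Lc) (i + 1) (k - 1 - i))
              (unitS (sfStep Lc (i + 1)) (smStep 3 Lc (i + 1)) (freshAt Lc (toSite rr) 0 cΛ (i + 1))) κ' u')
          - fun κ' u' => (cE * (Lc : ℝ) ^ (2 * (3 + 1))) ^ (k - i) •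
            push₃ (legChain (respStepBmSeq (toSite rr) Lc) i (k - 1 - i)) (legChain (respStepBmSeq (toSite rr) Lc) i (k - 1 - i))
              (legChain (respStepBmSeq (toSite rr) Lc) i (k - 1 - i))
              (unitS (sfStep Lc i) (smStep 3 Lc i) (freshAt Lc (toSite rr) 0 cΛ i)) κ' u')
        (CP * ((((k - i : ℕ) : ℝ)) ^ q * Θ ^ k)) δP) :
    ∃ cB θB δB : ℝ, 0 ≤ cB ∧ 0 ≤ θB ∧ θB < 1 ∧ 0 < δB ∧ ∀ (rr : Fin (3 + 1) → ℕ), rr ∈ box (3 + 1) Lc → ∀ k j : ℕ,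
      LocStencil (unitS (sfStep Lc (k + j)) (smStep 3 Lc (k + j)) (bornSecAt Lc (toSite rr) cE 0 cΛ (k + j))
        - unitS (sfStep Lc k) (smStep 3 Lc k) (bornSecAt Lc (toSite rr) cE 0 cΛ k)) (cB * θB ^ k) δB :=
  exists_hBdevLam_of_letters (d := 3) cE cΛ (exists_hXd_lam_three hLc cΛ) (exists_hT_lam_three hLc hcE cΛ) hP

end Discharge

end Summit.QuantumFields.BalabanUV.Beta.GAN24.BornLambdaDrift

end
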